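import Summits.Ventures.HSemireg.GeneralStructureWiring
import Summits.Ventures.HSemireg.GeneralStructureWiringPrimitiveMiddle
import Summits.HodgeConjecture.HodgeConjecture.Theorems.PadicSemiregularLiftHodgeAbelianVarietiesStubCmAnchoredFamilies
import HarnessLib

/-!
# HSemireg venture · general structure — the DEFORMATION-FREE instance (★) of the uniform lifts (red-team GS-8(b)/GS-9 made kernel-exact)

HONEST FRAMING (cell `pub-hsemireg`, team «general structure», seat `deform-ring2`; verbatim the cell's rule): nothing here says
`HC_AV` or `HC_CM` is proved. Ring-2 framing, verbatim: research route conditional on HC_CM; not a corollary; Q11.4-sentence-2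
already refuted in dim ≥ 3. This file asserts NOTHING: it SPECIALISES seat G4's `@[conjecture]` hypotheses (which are NOT asserted)
to the constant family over the point and records what they then say. No `sorry`, no new `def`, no new axiom, no Literature fact.

## Content

Red-team finding GS-9 (gs-red-g2, `general-structure/RED-GS.md` v3, 2026-08-22): every landed ∀-form of the team's hypothesis
ENTAILS the deformation-free statement

  (★)  for every CM abelian variety `A₀`, every `p` and every class `α ∈ H^{2p}(A₀(ℂ); ℂ)` that is rational, of type `(p,p)` AND
       algebraic, there are finitely many finite locally free `E_i`, degree sets `I_i ∋ p` with `E_i` `I_i`-semiregular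
       (Buchweitz–Flenner), and `c_i ∈ ℂ` with `α = Σ c_i ch_p(E_i)`,

because the base `S = Spec ℂ` (`𝟙_ (SchemeOver ℂ)`: quasi-projective, smooth, irreducible — ring 2's
`SubtorusGalleryBlochSeeds.Stubs.unit_base`) with the constant family `A₀ ⟶ Spec ℂ` (`isSmoothProjectiveFamily_toUnit`,
`fibreIncl_toUnit`, `hodgeAlong_toUnit`, all ring-2 tree theorems) satisfies every antecedent, and over a one-point base the
horizontality clause is idle. The theorems below are exactly that specialisation, kernel-checked, for the sheaf ∀-form
(`UniformSemiregularSheafLiftAtCM C`) and for its THINNED form (`UniformSemiregularSheafLiftAtCMPrimitiveMiddle C`, where (★) is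
restricted to `K₀`-primitive middle classes, `2p = dim A₀ ≥ 4`). The sheaves live on the fibre `A₀ ×_{Spec ℂ} Spec ℂ`, which
`fiberι` identifies with `A₀` (`isIso_fiberι_toUnit`); (★) is stated through that identification (no Chern-character transport
is used). By the span field of `ChernCharacterBetti` (`algebraicClasses_le_span_ch`, Fulton Ex. 15.2.16 (b)) the presentation
WITHOUT the semiregularity clause is automatic on any smooth projective variety; the content of (★) is the clause
`IsISemiregular (hE i) {q | q + 1 ∈ I_i}` with `p ∈ I_i`.

Consequence recorded for the GS report (numbers, not adjectives): the coverage tables (one representative at one CM point per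
Weil component) are NOT evidence for (★) at other CM abelian varieties / other algebraic classes; (★) is cheap exactly where the
Hodge ring is divisor-generated (ample line bundles are `{1,p}`-semiregular for `p ≤ dim − 1`, GS-9) and has content for
exceptional classes in degrees `2 ≤ p ≤ dim − 2`. A single CM `A₀` with a rational algebraic `(p,p)` class admitting no
semiregular locally free presentation refutes `UniformSemiregularSheafLiftAtCM C` (first theorem, contrapositive).

## References (bib keys)

BuchweitzFlenner2003 (§5 Thm. 5.1, Def. 4.1), Bloch1972Semiregularity (Introduction p. 51), Fulton1998 (Ex. 15.2.16 (b)),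
MumfordAV1970 (§22, CM type).
-/

noncomputable section

open CategoryTheory MonoidalCategory
open Literature.AlgebraicGeometry Literature.AlgebraicGeometry.Motives
open Literature.AlgebraicGeometry.HodgeTheory

namespace Summit.Ventures.HSemireg.GeneralStructure

open Summit.HodgeConjecture.HodgeConjecture
open Summit.HodgeConjecture.HodgeConjecture.Cruxes.HodgeAbelianVarieties.SubtorusGalleryBlochSeeds.Stubs
  (unit_base isSmoothProjectiveFamily_toUnit fibreIncl_toUnit hodgeAlong_toUnit isIso_fiberι_toUnit)

/-- **(★) from the sheaf ∀-form — GS-9 kernel-exact.** If `UniformSemiregularSheafLiftAtCM C` holds then on every CM abelian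
variety `A₀` every rational, `(p,p)`, ALGEBRAIC class `α` has a Buchweitz–Flenner semiregular finite-locally-free presentation
`α|_{A₀ ×_{Spec ℂ} u} = Σ c_i ch_p(E_i)`, `p ∈ I_i`, `E_i` `I_i`-semiregular — the hypothesis specialised to the constant family
over the point (every antecedent discharged by ring-2 tree theorems; the horizontality clause is dropped). NOT asserted: the
hypothesis is the team's OPEN, SPECULATIVE `@[conjecture]` def. [cite: BuchweitzFlenner2003, §5 Thm. 5.1 and Def. 4.1]
[cite: Fulton1998, Example 15.2.16 (b)] [cite: MumfordAV1970, §22 (CM type)] -/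
theorem semiregularPresentationAtCM_of_uniformSheafLift (C : ChernCharacterBetti)
    (hL : UniformSemiregularSheafLiftAtCM C) (A₀ : AbelianVariety ℂ)
    (hCM : ∃ (ψ : A₀ ⟶ A₀) (μ : Fin (2 * AbelianVariety.dim A₀) → ℂ), Function.Injective μ ∧
      ∀ i, Module.End.HasEigenvalue (HodgeTheory.complexBetti.map ψ.hom.hom.hom 1).hom (μ i))
    (p : ℕ) (α : HodgeTheory.complexBetti A₀.X (2 * p)) (hrat : IsRationalClass α)
    (halg : α ∈ HodgeTheory.algebraicClasses A₀.X p) (u : ComplexPoints (𝟙_ (SchemeOver ℂ))) :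
    ∃ (r : ℕ) (c : Fin r → ℂ) (E : Fin r → (fiberOver (CartesianMonoidalCategory.toUnit A₀.X) u).left.Modules)
      (hE : ∀ i, IsFiniteLocallyFree (E i)) (Ideg : Fin r → Finset ℕ),
      (∀ i, p ∈ Ideg i) ∧ (∀ i, IsISemiregular (hE i) {q | q + 1 ∈ Ideg i}) ∧
      complexBetti.map (fiberι (CartesianMonoidalCategory.toUnit A₀.X) u) (2 * p) α =
        ∑ i, c i • C.ch (fiberOver (CartesianMonoidalCategory.toUnit A₀.X) u) (E i) p := by
  have hX : IsSmoothProjective A₀.dim A₀.X := AbelianVariety.isSmoothProjective_holds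
  have hh : IsOfHodgeType A₀.dim A₀.X (2 * p) p p α :=
    isOfHodgeType_of_mem_algebraicClasses_of_isSmoothProjective hX p halg
  have halg' : HodgeTheory.complexBetti.map (𝟙 A₀.X) (2 * p) α ∈ HodgeTheory.algebraicClasses A₀.X p := by
    rw [HodgeTheory.complexBetti.map_id]; exact halg
  obtain ⟨U, hu, -, r, c, E, hE, Ideg, hp, hsr, hsum, -⟩ :=
    hL (𝟙_ (SchemeOver ℂ)) A₀.X (CartesianMonoidalCategory.toUnit A₀.X) A₀.dim p α u A₀ (𝟙 A₀.X)
      (HodgeTheory.IsQuasiProjectiveOver.of_isProjectiveOver hX.isProjectiveOver) unit_base.1 unit_base.2.1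
      unit_base.2.2 (isSmoothProjectiveFamily_toUnit A₀) (fibreIncl_toUnit A₀ u) hCM halg' (hodgeAlong_toUnit hrat hh)
  exact ⟨r, c, E, hE, Ideg, hp, hsr, hsum⟩

/-- **(★) restricted to primitive middle classes, from the THINNED sheaf ∀-form.** If
`UniformSemiregularSheafLiftAtCMPrimitiveMiddle C` holds then on every CM abelian variety `A₀` of dimension `2p ≥ 4`, every
rational `(p,p)` ALGEBRAIC class `α` that is `K₀`-primitive for a polarisation class `K₀` (pulled back from a class on `A₀`,
so that it is defined on the one fibre of the constant family) has a Buchweitz–Flenner semiregular finite-locally-free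
presentation on `A₀ ×_{Spec ℂ} u`. Same specialisation; NOT asserted. [cite: BuchweitzFlenner2003, §5 Thm. 5.1 and Def. 4.1]
[cite: VoisinHodgeI2002, §6.2.3 (primitive classes)] -/
theorem semiregularPresentationAtCM_primitiveMiddle_of_uniformSheafLiftPrimitiveMiddle (C : ChernCharacterBetti)
    (hL : UniformSemiregularSheafLiftAtCMPrimitiveMiddle C) (A₀ : AbelianVariety ℂ)
    (hCM : ∃ (ψ : A₀ ⟶ A₀) (μ : Fin (2 * AbelianVariety.dim A₀) → ℂ), Function.Injective μ ∧
      ∀ i, Module.End.HasEigenvalue (HodgeTheory.complexBetti.map ψ.hom.hom.hom 1).hom (μ i))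
    (p : ℕ) (hp : 2 ≤ p) (hdim : 2 * p = A₀.dim) (α : HodgeTheory.complexBetti A₀.X (2 * p))
    (hrat : IsRationalClass α) (halg : α ∈ HodgeTheory.algebraicClasses A₀.X p)
    (K : HodgeTheory.complexBetti A₀.X 2)
    (hK : ∀ t : ComplexPoints (𝟙_ (SchemeOver ℂ)), HodgeTheory.IsPolarizationClass A₀.dim
      (fiberOver (CartesianMonoidalCategory.toUnit A₀.X) t)
      (HodgeTheory.complexBetti.map (fiberι (CartesianMonoidalCategory.toUnit A₀.X) t) 2 K))
    (hprim : ∀ t : ComplexPoints (𝟙_ (SchemeOver ℂ)),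
      HodgeTheory.complexBetti.map (fiberι (CartesianMonoidalCategory.toUnit A₀.X) t) (2 * p) α ∈
        HodgeTheory.primitiveClasses
          (HodgeTheory.complexBetti.map (fiberι (CartesianMonoidalCategory.toUnit A₀.X) t) 2 K) A₀.dim (2 * p))
    (u : ComplexPoints (𝟙_ (SchemeOver ℂ))) :
    ∃ (r : ℕ) (c : Fin r → ℂ) (E : Fin r → (fiberOver (CartesianMonoidalCategory.toUnit A₀.X) u).left.Modules)
      (hE : ∀ i, IsFiniteLocallyFree (E i)) (Ideg : Fin r → Finset ℕ),
      (∀ i, p ∈ Ideg i) ∧ (∀ i, IsISemiregular (hE i) {q | q + 1 ∈ Ideg i}) ∧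
      complexBetti.map (fiberι (CartesianMonoidalCategory.toUnit A₀.X) u) (2 * p) α =
        ∑ i, c i • C.ch (fiberOver (CartesianMonoidalCategory.toUnit A₀.X) u) (E i) p := by
  have hX : IsSmoothProjective A₀.dim A₀.X := AbelianVariety.isSmoothProjective_holds
  have hh : IsOfHodgeType A₀.dim A₀.X (2 * p) p p α :=
    isOfHodgeType_of_mem_algebraicClasses_of_isSmoothProjective hX p halg
  have halg' : HodgeTheory.complexBetti.map (𝟙 A₀.X) (2 * p) α ∈ HodgeTheory.algebraicClasses A₀.X p := by
    rw [HodgeTheory.complexBetti.map_id]; exact halg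
  have h4 : 4 ≤ A₀.dim := by omega
  obtain ⟨U, hu, -, r, c, E, hE, Ideg, hp', hsr, hsum, -⟩ :=
    hL (𝟙_ (SchemeOver ℂ)) A₀.X (CartesianMonoidalCategory.toUnit A₀.X) A₀.dim p α u A₀ (𝟙 A₀.X) h4 hp hdim
      (HodgeTheory.IsQuasiProjectiveOver.of_isProjectiveOver hX.isProjectiveOver) unit_base.1 unit_base.2.1
      unit_base.2.2 (isSmoothProjectiveFamily_toUnit A₀) (fibreIncl_toUnit A₀ u) hCM halg' (hodgeAlong_toUnit hrat hh)
      K hK hprim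
  exact ⟨r, c, E, hE, Ideg, hp', hsr, hsum⟩

/-- **Contrapositive, the cheapest falsifier of the sheaf ∀-form (GS-9):** ONE CM abelian variety with ONE rational algebraic
`(p,p)` class admitting no semiregular finite-locally-free presentation (on the fibre of the constant family) refutes
`UniformSemiregularSheafLiftAtCM C`. [cite: BuchweitzFlenner2003, §5 Thm. 5.1 and Def. 4.1] -/
theorem not_uniformSheafLift_of_noSemiregularPresentation (C : ChernCharacterBetti) (A₀ : AbelianVariety ℂ)
    (hCM : ∃ (ψ : A₀ ⟶ A₀) (μ : Fin (2 * AbelianVariety.dim A₀) → ℂ), Function.Injective μ ∧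
      ∀ i, Module.End.HasEigenvalue (HodgeTheory.complexBetti.map ψ.hom.hom.hom 1).hom (μ i))
    (p : ℕ) (α : HodgeTheory.complexBetti A₀.X (2 * p)) (hrat : IsRationalClass α)
    (halg : α ∈ HodgeTheory.algebraicClasses A₀.X p) (u : ComplexPoints (𝟙_ (SchemeOver ℂ)))
    (hno : ¬ ∃ (r : ℕ) (c : Fin r → ℂ) (E : Fin r → (fiberOver (CartesianMonoidalCategory.toUnit A₀.X) u).left.Modules)
      (hE : ∀ i, IsFiniteLocallyFree (E i)) (Ideg : Fin r → Finset ℕ),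
      (∀ i, p ∈ Ideg i) ∧ (∀ i, IsISemiregular (hE i) {q | q + 1 ∈ Ideg i}) ∧
      complexBetti.map (fiberι (CartesianMonoidalCategory.toUnit A₀.X) u) (2 * p) α =
        ∑ i, c i • C.ch (fiberOver (CartesianMonoidalCategory.toUnit A₀.X) u) (E i) p) :
    ¬ UniformSemiregularSheafLiftAtCM C :=
  fun hL ↦ hno (semiregularPresentationAtCM_of_uniformSheafLift C hL A₀ hCM p α hrat halg u)

#print axioms Summit.Ventures.HSemireg.GeneralStructure.semiregularPresentationAtCM_of_uniformSheafLift
#print axioms Summit.Ventures.HSemireg.GeneralStructure.semiregularPresentationAtCM_primitiveMiddle_of_uniformSheafLiftPrimitiveMiddle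

end Summit.Ventures.HSemireg.GeneralStructure

end
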